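import Literature.NumberTheory.LFunctions.Zhang2022.RepairGapLemma58Premise
import Literature.NumberTheory.LFunctions.Zhang2022.RepairGapLemma57Premise
import Literature.NumberTheory.LFunctions.Zhang2022.Section15ResidueNonvanishing
import HarnessLib

/-!
# Zhang (2022), rescue GAP/BED (D-0124 (3)(4)): the three (A)-doors of the Part III residue chain
# (§15 `ℛ₁*`, `ℛ₁ⱼ`; §16 `𝓡₂*`, `𝓡₂ⱼ` — the inputs of node (18.1)) under the minimum premise
# `‖L(1,χ)‖ ≤ 𝓛⁻¹⁵` (GAP G-31 «(A)-exponent E: main terms only E ≥ 15»; bed-2 NODE2-STEP-LEDGER §6)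

Topic `Literature/NumberTheory/LFunctions/Zhang2022` (Landau–Siegel audit tree; verdict-neutral).
Y. Zhang, *Discrete mean estimates and the Landau–Siegel zero*, arXiv:2211.02515v1 (2022)
[Zhang2022LandauSiegel] — **an unrefereed manuscript under adjudication; nothing in this file asserts or
denies its Theorems 1–2, and nothing here is a claim about Landau–Siegel zeros. The programme SEARCHES and
TYPES; no claim about Landau–Siegel zeros, Theorems 1–2 of arXiv:2211.02515 or a repaired Margin232 until a
kernel theorem says so.**

In the tree, the §15–§16 residue evaluations that feed the constant `𝔠₃` of (18.1)–(18.3) («By Lemma 5.8,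
`ℛ₁* = β₁β₂L′(1,χ) + O(𝓛⁻²⁴)`», §15 p. 88; «`𝓡₂* = β₁ + O(𝓛⁻¹⁰)`, `𝓡₂ⱼ = −1/(β₁L′(1,χ)) + O(𝓛⁶)`», §16
p. 95; the factors `L(1−β,χ) = −βL′(1,χ)(1+O(𝓛⁻⁶))` of `ℛ₁ⱼ`, `ℛ₂ⱼ`) consume Assumption (A) through exactly
THREE entry points, each typed under the printed `Skeleton.AssumptionA` (`‖L(1,χ)‖ < 𝓛⁻²⁰²²`):
* the Lemma 5.7 lower bound `D/φ(D) ≤ 4e‖L′(1,χ)‖` (`Skeleton.self_div_totient_le_norm_deriv_L_one`,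
  `ResidueValues.norm_deriv_LFunction_one_ge`);
* Lemma 5.8 at a shift, `‖L(1+z,χ) − L′(1,χ)z‖ ≤ C₅₈𝓛⁻¹⁵` for `‖z‖ ≤ 3α` (`Skeleton.lemma58_at_shift`);
* the quotient form `L(1−β,χ)/(−βL′(1,χ)) = 1 + O(𝓛⁻⁶)`, `α/2 ≤ ‖β‖ ≤ 4α`
  (`ResidueValues.L_one_sub_beta_bounds`).
This file proves the same three statements, SAME CONSTANTS, with the guard `AssumptionA D χ` replaced by the
weaker premise `‖L(1,χ)‖ ≤ 𝓛⁻¹⁵` (the Lemma 5.8 door, `Repair.Gap.lemma58_of_norm_le_pow15`, p561913) — the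
Lemma 5.7 door needs only `‖L(1,χ)‖ ≤ c/𝓛` (`Repair.Gap.lemma57_of_norm_le`, p562983), which `𝓛⁻¹⁵` implies for
`𝓛¹⁴ ≥ 1/c` — together with the two transfer lemmas that turn any eventual statement guarded by
`‖L(1,χ)‖ ≤ 𝓛⁻¹⁵` back into the printed guard (`forAllLarge_assumptionA_of_pow15`) or into
`Repair.Bed.AssumptionAWith E` for every real `E ≥ 15` (`forAllLarge_assumptionAWith_of_pow15`). The §15/§16
node twins (`step15_u058`, `rhoStar_estimate`, `rho2_estimate`, the residue estimates) then follow from the tree's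
pointwise cores with these doors in place of the (A)-guarded ones (sibling files). Theorems only; no definition,
no named fact; nothing about (A) itself.

## References

* Y. Zhang, arXiv:2211.02515v1 (2022), §5 Lemmas 5.7–5.8 (p. 11); §15 p. 88; §16 p. 95; Assumption (A) p. 4.
  [cite: Zhang2022LandauSiegel, §5, Lemmas 5.7–5.8; §15 p. 88; §16 p. 95]
-/

noncomputable section

open Complex Real

namespace Literature.NumberTheory.LFunctions.Zhang2022.Repair.Gap

open Literature.NumberTheory.LFunctions.Zhang2022.Skeleton
open Literature.NumberTheory.LFunctions.Zhang2022.Repair.Bed (AssumptionAWith)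

/-! ## Transfer: an eventual statement under `‖L(1,χ)‖ ≤ 𝓛⁻¹⁵` gives the printed-guard statement -/

/-- `D ≥ 3 ⇒ log D ≥ 1`. [cite: Zhang2022LandauSiegel, §2 p. 4] -/
private theorem one_le_log_of_three_le {D : ℕ} (hD : 3 ≤ D) : 1 ≤ Real.log D := by
  have h3 : (3 : ℝ) ≤ D := by exact_mod_cast hD
  have he : Real.exp 1 ≤ 3 := by
    have := Real.exp_one_lt_d9
    linarith
  exact (Real.le_log_iff_exp_le (by linarith)).mpr (he.trans h3)

/-- For every `M` there is `D₀` with `M ≤ log D` for all `D ≥ D₀`. [cite: Zhang2022LandauSiegel, §2 p. 4] -/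
private theorem exists_forall_le_log (M : ℝ) : ∃ D₀ : ℕ, ∀ D : ℕ, D₀ ≤ D → M ≤ Real.log D := by
  refine ⟨⌈Real.exp M⌉₊ + 1, fun D hD => ?_⟩
  have hD1 : (⌈Real.exp M⌉₊ : ℝ) + 1 ≤ D := by exact_mod_cast hD
  have hD0 : (0 : ℝ) < D := by linarith [Nat.le_ceil (Real.exp M), Real.exp_pos M]
  rw [Real.le_log_iff_exp_le hD0]
  linarith [Nat.le_ceil (Real.exp M)]

/-- **Transfer to the printed guard.** Any eventual statement over real primitive characters that holds under
the premise `‖L(1,χ)‖ ≤ 𝓛⁻¹⁵` holds under the printed Assumption (A) (`‖L(1,χ)‖ < 𝓛⁻²⁰²²`): for `D ≥ 3`,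
`𝓛 ≥ 1` and `𝓛⁻²⁰²² ≤ 𝓛⁻¹⁵`. So every `…_pow15` node twin below and in the sibling files IMPLIES the tree's
(A)-guarded node. [cite: Zhang2022LandauSiegel, §2 Assumption (A)] -/
theorem forAllLarge_assumptionA_of_pow15 {S : (D : ℕ) → [NeZero D] → DirichletCharacter ℂ D → Prop}
    (h : ForAllLarge fun D _ χ => ‖χ.LFunction 1‖ ≤ 1 / Real.log D ^ 15 → S D χ) :
    ForAllLarge fun D _ χ => AssumptionA D χ → S D χ := by
  obtain ⟨D₀, hD₀⟩ := h
  refine ⟨max D₀ 3, fun D _ χ hD hq hp hA => ?_⟩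
  refine hD₀ D χ (le_trans (le_max_left _ _) hD) hq hp ?_
  have hL1 : 1 ≤ Real.log D := one_le_log_of_three_le (le_trans (le_max_right _ _) hD)
  unfold AssumptionA at hA
  refine hA.le.trans ?_
  exact one_div_le_one_div_of_le (pow_pos (by linarith) _) (pow_le_pow_right₀ hL1 (by norm_num))

/-- **Transfer to every exponent `E ≥ 15`.** Any eventual statement that holds under `‖L(1,χ)‖ ≤ 𝓛⁻¹⁵` holds
under `Repair.Bed.AssumptionAWith E D χ` (`‖L(1,χ)‖ < 𝓛^{−E}`) for every real `E ≥ 15` (the printed (A) is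
`E = 2022`, `Repair.Bed.assumptionA_iff_with`). The kernel form of GAP G-31's «main terms only: E ≥ 15» for
the Part III residue chain. [cite: Zhang2022LandauSiegel, §2 Assumption (A)] -/
theorem forAllLarge_assumptionAWith_of_pow15 {S : (D : ℕ) → [NeZero D] → DirichletCharacter ℂ D → Prop}
    {E : ℝ} (hE : 15 ≤ E)
    (h : ForAllLarge fun D _ χ => ‖χ.LFunction 1‖ ≤ 1 / Real.log D ^ 15 → S D χ) :
    ForAllLarge fun D _ χ => AssumptionAWith E D χ → S D χ := by
  obtain ⟨D₀, hD₀⟩ := h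
  refine ⟨max D₀ 3, fun D _ χ hD hq hp hA => ?_⟩
  refine hD₀ D χ (le_trans (le_max_left _ _) hD) hq hp ?_
  have hL1 : 1 ≤ Real.log D := one_le_log_of_three_le (le_trans (le_max_right _ _) hD)
  unfold AssumptionAWith at hA
  have hpow : Real.log D ^ (15 : ℝ) ≤ Real.log D ^ E := Real.rpow_le_rpow_of_exponent_le hL1 hE
  have h15 : (0 : ℝ) < Real.log D ^ (15 : ℝ) := Real.rpow_pos_of_pos (by linarith) _
  have hle : 1 / Real.log D ^ E ≤ 1 / Real.log D ^ (15 : ℝ) := one_div_le_one_div_of_le h15 hpow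
  have hcast : Real.log D ^ (15 : ℝ) = Real.log D ^ (15 : ℕ) := by
    rw [show (15 : ℝ) = ((15 : ℕ) : ℝ) by norm_num, Real.rpow_natCast]
  rw [hcast] at hle
  exact hA.le.trans hle

/-! ## Door 1 — Lemma 5.7: `D/φ(D) ≤ 4e‖L′(1,χ)‖` under `‖L(1,χ)‖ ≤ 𝓛⁻¹⁵` -/

/-- **Lemma 5.7's lower bound under the minimum premise** (twin of `Skeleton.self_div_totient_le_norm_deriv_L_one`,
same constant): for all large `D` and every real primitive `χ (mod D)` with `‖L(1,χ)‖ ≤ 𝓛⁻¹⁵`,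
`D/φ(D) ≤ 4e‖L′(1,χ)‖`. From `Repair.Gap.lemma57_of_norm_le` (`Re L′(1,χ) ≥ (4e)⁻¹D/φ(D)` under
`‖L(1,χ)‖ ≤ c/𝓛`), since `𝓛⁻¹⁵ ≤ c/𝓛` once `𝓛 ≥ max(1, 1/c)`. [cite: Zhang2022LandauSiegel, §5, Lemma 5.7] -/
theorem self_div_totient_le_norm_deriv_L_one_pow15 :
    ForAllLarge fun D _ χ => ‖χ.LFunction 1‖ ≤ 1 / Real.log D ^ 15 →
      (D : ℝ) / Nat.totient D ≤ 4 * Real.exp 1 * ‖deriv χ.LFunction 1‖ := by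
  obtain ⟨L₀, c, hc, hL₀⟩ := lemma57_of_norm_le
  obtain ⟨D₀, hD₀⟩ := exists_forall_le_log (max L₀ (max 1 (1 / c)))
  refine ⟨D₀, fun D _ χ hD hq hp h15 => ?_⟩
  have hM := hD₀ D hD
  have hLL : L₀ ≤ Real.log D := le_trans (le_max_left _ _) hM
  have hL1 : 1 ≤ Real.log D := le_trans (le_trans (le_max_left _ _) (le_max_right _ _)) hM
  have hLc : 1 / c ≤ Real.log D := le_trans (le_trans (le_max_right _ _) (le_max_right _ _)) hM
  have hL0 : 0 < Real.log D := by linarith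
  -- `𝓛⁻¹⁵ ≤ c/𝓛`
  have hcL : ‖χ.LFunction 1‖ ≤ c / Real.log D := by
    refine h15.trans ?_
    rw [div_le_div_iff₀ (pow_pos hL0 _) hL0]
    have h14 : Real.log D ≤ Real.log D ^ 14 := by
      calc Real.log D = Real.log D ^ 1 := (pow_one _).symm
        _ ≤ Real.log D ^ 14 := pow_le_pow_right₀ hL1 (by norm_num)
    have h1c : 1 ≤ c * Real.log D ^ 14 := by
      have h := mul_le_mul_of_nonneg_left (hLc.trans h14) hc.le
      rwa [mul_one_div_cancel hc.ne'] at h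
    calc 1 * Real.log D = Real.log D := one_mul _
      _ ≤ (c * Real.log D ^ 14) * Real.log D := le_mul_of_one_le_left hL0.le h1c
      _ = c * Real.log D ^ 15 := by ring
  have h := (hL₀ D χ hp hq.sq_eq_one hLL hcL).trans (Complex.re_le_norm _)
  have he : Real.exp 1 * Real.exp (-1) = 1 := by rw [← Real.exp_add]; simp
  calc (D : ℝ) / Nat.totient D
      = 4 * Real.exp 1 * (Real.exp (-1) / 4 * ((D : ℝ) / Nat.totient D)) := by
        rw [show 4 * Real.exp 1 * (Real.exp (-1) / 4 * ((D : ℝ) / Nat.totient D)) =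
          (Real.exp 1 * Real.exp (-1)) * ((D : ℝ) / Nat.totient D) by ring, he, one_mul]
    _ ≤ 4 * Real.exp 1 * ‖deriv χ.LFunction 1‖ := by gcongr

/-- **`‖L′(1,χ)‖ ≥ (4e)⁻¹` under the minimum premise** (twin of `ResidueValues.norm_deriv_LFunction_one_ge`):
there is `c > 0` (namely `1/(4e)`) with `c ≤ ‖L′(1,χ)‖` for all large `D` and every real primitive `χ (mod D)`
with `‖L(1,χ)‖ ≤ 𝓛⁻¹⁵` (`D/φ(D) ≥ 1`). [cite: Zhang2022LandauSiegel, §5, Lemma 5.7] -/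
theorem norm_deriv_LFunction_one_ge_pow15 :
    ∃ c : ℝ, 0 < c ∧ ForAllLarge fun D _ χ => ‖χ.LFunction 1‖ ≤ 1 / Real.log D ^ 15 →
      c ≤ ‖deriv χ.LFunction 1‖ := by
  obtain ⟨D₀, h⟩ := self_div_totient_le_norm_deriv_L_one_pow15
  refine ⟨1 / (4 * Real.exp 1), by positivity, max D₀ 1, fun D _ χ hD hq hp h15 => ?_⟩
  have hD1 : 1 ≤ D := le_trans (le_max_right _ _) hD
  have hge := h D χ (le_trans (le_max_left _ _) hD) hq hp h15
  have hφ1 : 1 ≤ (D : ℝ) / Nat.totient D := by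
    rw [le_div_iff₀ (by exact_mod_cast Nat.totient_pos.mpr (by omega)), one_mul]
    exact_mod_cast Nat.totient_le D
  rw [div_le_iff₀ (by positivity)]
  linarith [hge, hφ1]

/-! ## Door 2 — Lemma 5.8 at a shift `‖z‖ ≤ 3α` under `‖L(1,χ)‖ ≤ 𝓛⁻¹⁵` -/

/-- **Lemma 5.8 at `1 + z`, `‖z‖ ≤ 3α`, under the minimum premise** (twin of `Skeleton.lemma58_at_shift`, same
constant `C₅₈ = 1 + 1600e^{9/2}π²`): `‖L(1+z,χ) − L′(1,χ)z‖ ≤ C₅₈𝓛⁻¹⁵` for `χ` primitive, `𝓛 ≥ 3`,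
`‖L(1,χ)‖ ≤ 𝓛⁻¹⁵` (`α = π𝓛⁻⁹`, so `3α ≤ 10π𝓛⁻⁹`). [cite: Zhang2022LandauSiegel, §5, Lemma 5.8] -/
theorem lemma58_at_shift_pow15 {D : ℕ} [NeZero D] (χ : DirichletCharacter ℂ D) (hp : χ.IsPrimitive)
    (hℓ3 : 3 ≤ ell D) (h15 : ‖χ.LFunction 1‖ ≤ 1 / Real.log D ^ 15) {z : ℂ} (hz : ‖z‖ ≤ 3 * alpha D) :
    ‖χ.LFunction (1 + z) - deriv χ.LFunction 1 * z‖ ≤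
      (1 + 16 * Real.exp (9 / 2) * π ^ 2 * 10 ^ 2) / ell D ^ 15 := by
  have hαeq : alpha D = π / ell D ^ 9 := Section2.alpha_eq_pi_div_ell9 D
  have hL' : 3 ≤ Real.log D := hℓ3
  have hKL : 10 * π ≤ Real.log D ^ 8 := by
    have : (3 : ℝ) ^ 8 ≤ Real.log D ^ 8 := pow_le_pow_left₀ (by norm_num) hL' 8
    linarith [Real.pi_lt_four]
  have hs : ‖(1 + z) - 1‖ ≤ 10 * π / Real.log D ^ 9 := by
    rw [add_sub_cancel_left]
    refine hz.trans ?_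
    rw [hαeq, ell, mul_div_assoc']
    gcongr
    linarith
  have h := lemma58_of_norm_le_pow15 χ hp hL' h15 hKL hs
  rw [add_sub_cancel_left] at h
  exact h

/-- **Lemma 5.8 at `1 + z` on the full printed range `‖z‖ ≤ 10α` under the minimum premise** (same constant):
the shifts `β₁, β₂, β₃, 2β₁, −β_k` of §§15–16 all lie in `‖z‖ ≤ 4α`. [cite: Zhang2022LandauSiegel, §5, Lemma 5.8] -/
theorem lemma58_at_shift_pow15' {D : ℕ} [NeZero D] (χ : DirichletCharacter ℂ D) (hp : χ.IsPrimitive)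
    (hℓ3 : 3 ≤ ell D) (h15 : ‖χ.LFunction 1‖ ≤ 1 / Real.log D ^ 15) {z : ℂ} (hz : ‖z‖ ≤ 10 * alpha D) :
    ‖χ.LFunction (1 + z) - deriv χ.LFunction 1 * z‖ ≤
      (1 + 16 * Real.exp (9 / 2) * π ^ 2 * 10 ^ 2) / ell D ^ 15 := by
  have hαeq : alpha D = π / ell D ^ 9 := Section2.alpha_eq_pi_div_ell9 D
  have hL' : 3 ≤ Real.log D := hℓ3
  have hKL : 10 * π ≤ Real.log D ^ 8 := by
    have : (3 : ℝ) ^ 8 ≤ Real.log D ^ 8 := pow_le_pow_left₀ (by norm_num) hL' 8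
    linarith [Real.pi_lt_four]
  have hs : ‖(1 + z) - 1‖ ≤ 10 * π / Real.log D ^ 9 := by
    rw [add_sub_cancel_left]
    refine hz.trans (le_of_eq ?_)
    rw [hαeq, ell, mul_div_assoc']
  have h := lemma58_of_norm_le_pow15 χ hp hL' h15 hKL hs
  rw [add_sub_cancel_left] at h
  exact h

/-! ## Door 3 — `L(1−β,χ) = −βL′(1,χ)(1 + O(𝓛⁻⁶))` under `‖L(1,χ)‖ ≤ 𝓛⁻¹⁵` -/

/-- **The factor `L(1−β,χ)` of `ℛ₁ⱼ`, `ℛ₂ⱼ` under the minimum premise** (twin of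
`ResidueValues.L_one_sub_beta_bounds`; constant `C = 2C₅₈/(πc)` with `c = 1/(4e)` from Door 1): for all large
`D`, every real primitive `χ (mod D)` with `‖L(1,χ)‖ ≤ 𝓛⁻¹⁵` and every `β` with `α/2 ≤ ‖β‖ ≤ 4α`:
`L(1−β,χ) ≠ 0`, `‖L(1−β,χ)/(−βL′(1,χ)) − 1‖ ≤ C𝓛⁻⁶` and `C𝓛⁻⁶ ≤ 1/2` — the tree's proof verbatim with the
(A)-guarded Lemma 5.7/5.8 replaced by Doors 1–2. [cite: Zhang2022LandauSiegel, §15 (15.16), §16 (16.11)] -/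
theorem L_one_sub_beta_bounds_pow15 : ∃ C : ℝ, 0 ≤ C ∧ ForAllLarge fun D _ χ =>
    ‖χ.LFunction 1‖ ≤ 1 / Real.log D ^ 15 →
    ∀ β : ℂ, alpha D / 2 ≤ ‖β‖ → ‖β‖ ≤ 4 * alpha D →
      χ.LFunction (1 - β) ≠ 0 ∧
        ‖χ.LFunction (1 - β) / (-β * deriv χ.LFunction 1) - 1‖ ≤ C / ell D ^ 6 ∧
          C / ell D ^ 6 ≤ 1 / 2 := by
  obtain ⟨c, hc, D₀, h57⟩ := norm_deriv_LFunction_one_ge_pow15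
  set C₈ : ℝ := 1 + 16 * Real.exp (9 / 2) * π ^ 2 * 10 ^ 2 with hC₈
  have hC₈0 : 0 ≤ C₈ := by positivity
  set C : ℝ := 2 * C₈ / (π * c) with hCdef
  have hC0 : 0 ≤ C := by positivity
  refine ⟨C, hC0, max D₀ (max ⌈Real.exp 3⌉₊ ⌈Real.exp (2 * C + 1)⌉₊),
    fun D _ χ hD hq hp h15 β hβl hβu => ?_⟩
  have hD₀ : D₀ ≤ D := le_trans (le_max_left _ _) hD
  have hL : 3 ≤ ell D :=
    three_le_ell_of_le (le_trans (le_trans (le_max_left _ _) (le_max_right _ _)) hD)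
  have hℓ : 0 < ell D := by linarith
  have hℓ1 : 1 ≤ ell D := by linarith
  have hα := ResidueValues.alpha_pos hL
  have hαeq := Section2.alpha_eq_pi_div_ell9 D
  have hcL : c ≤ ‖deriv χ.LFunction 1‖ := h57 D χ hD₀ hq hp h15
  -- `C/𝓛⁶ ≤ 1/2`
  have hC6 : C / ell D ^ 6 ≤ 1 / 2 := by
    have h2C : 2 * C + 1 ≤ ell D := by
      have h : Real.exp (2 * C + 1) ≤ D := le_trans (Nat.le_ceil _)
        (by exact_mod_cast le_trans (le_trans (le_max_right _ _) (le_max_right _ _)) hD)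
      exact (Real.le_log_iff_exp_le (lt_of_lt_of_le (Real.exp_pos _) h)).mpr h
    have h6 : ell D ≤ ell D ^ 6 := by
      calc ell D = ell D ^ 1 := (pow_one _).symm
        _ ≤ ell D ^ 6 := pow_le_pow_right₀ hℓ1 (by norm_num)
    rw [div_le_iff₀ (by positivity)]
    nlinarith
  -- Lemma 5.8 at `s = 1 − β` (Door 2 on `‖−β‖ ≤ 4α ≤ 10α`)
  have hz : ‖-β‖ ≤ 10 * alpha D := by rw [norm_neg]; linarith
  have h58 := lemma58_at_shift_pow15' χ hp hL h15 hz
  rw [← sub_eq_add_neg, ← hC₈] at h58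
  -- divide by `|−βL′| ≥ αc/2`
  set L1 : ℂ := deriv χ.LFunction 1 with hL1
  have hden : alpha D / 2 * c ≤ ‖-β * L1‖ := by
    rw [norm_mul, norm_neg]; exact mul_le_mul hβl hcL hc.le (norm_nonneg _)
  have hdenpos : 0 < ‖-β * L1‖ := lt_of_lt_of_le (by positivity) hden
  have hden0 : -β * L1 ≠ 0 := fun h => by rw [h, norm_zero] at hdenpos; exact lt_irrefl _ hdenpos
  have hratio : ‖χ.LFunction (1 - β) / (-β * L1) - 1‖ ≤ C / ell D ^ 6 := by
    have hrew : χ.LFunction (1 - β) / (-β * L1) - 1 =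
        (χ.LFunction (1 - β) - L1 * -β) / (-β * L1) := by
      rw [div_sub_one hden0]; congr 1; ring
    rw [hrew, norm_div]
    calc ‖χ.LFunction (1 - β) - L1 * -β‖ / ‖-β * L1‖
        ≤ (C₈ / ell D ^ 15) / (alpha D / 2 * c) := div_le_div₀ (by positivity) h58 (by positivity) hden
      _ = C / ell D ^ 6 := by
          rw [hCdef, hαeq]; field_simp
  refine ⟨?_, hratio, hC6⟩
  intro h0
  rw [h0, zero_div, zero_sub, norm_neg, norm_one] at hratio
  linarith

/-- **Door 3 under every exponent `E ≥ 15`** — an instance of the transfer lemma, recorded for the GAP row: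
`Repair.Bed.AssumptionAWith E` (any real `E ≥ 15`, the printed one being `2022`) gives the factor estimate with the
same constant. [cite: Zhang2022LandauSiegel, §15 (15.16), §16 (16.11)] -/
theorem L_one_sub_beta_bounds_of_assumptionAWith {E : ℝ} (hE : 15 ≤ E) :
    ∃ C : ℝ, 0 ≤ C ∧ ForAllLarge fun D _ χ => AssumptionAWith E D χ →
    ∀ β : ℂ, alpha D / 2 ≤ ‖β‖ → ‖β‖ ≤ 4 * alpha D →
      χ.LFunction (1 - β) ≠ 0 ∧
        ‖χ.LFunction (1 - β) / (-β * deriv χ.LFunction 1) - 1‖ ≤ C / ell D ^ 6 ∧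
          C / ell D ^ 6 ≤ 1 / 2 := by
  obtain ⟨C, hC0, h⟩ := L_one_sub_beta_bounds_pow15
  exact ⟨C, hC0, forAllLarge_assumptionAWith_of_pow15 hE h⟩

/-- **Door 1 under every exponent `E ≥ 15`** (rev 2; instance of the transfer lemma, recorded next to Door 3's): from
`Repair.Bed.AssumptionAWith E D χ` with any real `E ≥ 15` (printed: `2022`), for all large `D` and every real primitive
`χ (mod D)`, `‖L′(1,χ)‖ ≥ c = 1/(4e)`. (Lemma 5.7 itself needs only `E > 1`: `lemma57_divisors_of_assumptionAWith`.)
[cite: Zhang2022LandauSiegel, §5, Lemma 5.7] -/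
theorem norm_deriv_LFunction_one_ge_of_assumptionAWith {E : ℝ} (hE : 15 ≤ E) :
    ∃ c : ℝ, 0 < c ∧ ForAllLarge fun D _ χ => AssumptionAWith E D χ → c ≤ ‖deriv χ.LFunction 1‖ := by
  obtain ⟨c, hc, h⟩ := norm_deriv_LFunction_one_ge_pow15
  exact ⟨c, hc, forAllLarge_assumptionAWith_of_pow15 hE h⟩

end Literature.NumberTheory.LFunctions.Zhang2022.Repair.Gap
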